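import Mathlib
import HarnessLib
import Summits.Ventures.LatticeQCDFlow.Scoring.ChainMartingaleIncrements

/-!
# A martingale increment against the future: `E[G · D_b · g(X_{b+1+m})] = E[G · c_{K^m g}(X_b)]` with
# the one-step covariance `c_φ = kop κ (h φ) − kop κ h · kop κ φ`, and `|…| ≤ 4 C_h C_g A ρ^m E|G|`
# under a geometric sup-norm envelope

HONEST FRAMING: exact (Metropolis-corrected) sampling algorithms for lattice gauge theory;
figures of merit are autocorrelation/cost numbers at stated couplings and volumes; no
continuum-physics claim.

Venture `LatticeQCDFlow` (cell pub-lqcd), topic `Scoring`; FANOUT row 8 (`s0-cpn-nemc`, GEN-21).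
NEW WORK of the cell, not a published result; no definition is introduced; nothing is cited as a
fact.  Notation of `Scoring/ChainMartingaleIncrements.lean`: `P_{μ₀}` the path law of the chain with
kernel `κ` from any initial law, `|h| ≤ C_h` bounded measurable, `D_b = h(X_{b+1}) − kop κ h(X_b)` the
martingale increment, `G` a bounded measurable functional of the history up to time `b`
(`DependsOn G (Set.Iic b)`).  GEN-19 proved `E[G D_b] = 0` and `E[G D_b²] = E[G q(X_b)]`.  This file
adds the increment AGAINST A FUTURE OBSERVABLE: (i) `E[G · D_b · g(X_{b+1})] = E[G · c_g(X_b)]` with the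
one-step covariance `c_g(x) = kop κ (h g)(x) − kop κ h(x) · kop κ g(x) = Cov_{κ(x,·)}(h, g)` (tower
property twice); (ii) `c_g` is unchanged when a constant is subtracted from `g`, so
`|c_g| ≤ 2 C_h sup|g − m|` for every constant `m`; (iii) `E[G · D_b · g(X_{b+1+m})] =
E[G · D_b · ((kop κ)^[m] g)(X_{b+1})]` (the `m`-step tower property with the functional `G · D_b` of the
history up to `b + 1`); hence (iv) under the envelope `|(kop κ)^[m] g − πg| ≤ 2 C_g A ρ^m`:
`|E[G · D_b · g(X_{b+1+m})]| ≤ 4 C_h C_g A ρ^m · E|G|` — an increment decorrelates from every later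
observation at the geometric rate of the GAP, whatever bounded past functional multiplies it.  With
`G` itself an earlier increment this gives decay in BOTH gaps
(`Scoring/BlockMartingaleFourthMomentLeading.lean`), the input of the leading constant `3 σ⁴_f n²` of
the fourth moment of block sums and of the `2 σ⁴_f/a` variance of the batch-means estimator.
Printed counterpart NAMED ONLY: mixing / cumulant bounds for functionals of uniformly ergodic chains
(Ibragimov 1962; Meyn–Tweedie 1993 Ch. 16–17), nothing cited as a fact.

## Content (`κ` Markov, `μ₀` any probability law; `|h| ≤ C_h`, `|g| ≤ C_g` measurable; `G` bounded
## measurable with `DependsOn G (Set.Iic b)`)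

* `kopCov_eq_sub_const` — `kop κ (h g) x − kop κ h x · kop κ g x = kop κ (h (g − m)) x − kop κ h x · kop κ (g − m) x`;
  `abs_kopCov_le` — `|g − m| ≤ δ` ⇒ `|kop κ (h g) x − kop κ h x · kop κ g x| ≤ 2 C_h δ`;
  `kopCov_bounded_measurable`;
* **`chain_increment_mul_next`** — `E[G · D_b · g(X_{b+1})] = E[G · (kop κ (h g) − kop κ h · kop κ g)(X_b)]`;
* **`chain_increment_mul_future`** — `E[G · D_b · g(X_{b+1+m})] = E[G · D_b · ((kop κ)^[m] g)(X_{b+1})]`;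
* **`abs_chain_increment_mul_future_le_of_envelope`** —
  `|E[G · D_b · g(X_{b+1+m})]| ≤ 4 C_h C_g (A ρ^m) ∫ |G| dP_{μ₀}`.

NOT CLAIMED: anything about a concrete sampler; unbounded observables.
-/

noncomputable section

namespace Summit.Ventures.LatticeQCDFlow.Scoring

open MeasureTheory ProbabilityTheory Filter Finset Preorder Literature.Probability.MarkovChains
open scoped ENNReal Topology

variable {Ω : Type*} [MeasurableSpace Ω]

/-! ### The one-step covariance `kop κ (h g) − kop κ h · kop κ g` -/

section Kernel

variable (κ : Kernel Ω Ω) [IsMarkovKernel κ]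

/-- **Shift invariance of the one-step covariance**: for bounded measurable `h, g` and any constant
`m`: `kop κ (h g) x − kop κ h x · kop κ g x = kop κ (h (g − m)) x − kop κ h x · kop κ (g − m) x`. -/
theorem kopCov_eq_sub_const {h g : Ω → ℝ} (hh : Measurable h) {Ch : ℝ} (hCh : ∀ x, |h x| ≤ Ch)
    (hg : Measurable g) {Cg : ℝ} (hCg : ∀ x, |g x| ≤ Cg) (m : ℝ) (x : Ω) :
    kop κ (fun y => h y * g y) x - kop κ h x * kop κ g x
      = kop κ (fun y => h y * (g y - m)) x - kop κ h x * kop κ (fun y => g y - m) x := by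
  have hCh0 : 0 ≤ Ch := (abs_nonneg _).trans (hCh x)
  have hihg : Integrable (fun y => h y * g y) (κ x) :=
    integrable_of_bounded (κ x) (hh.mul hg) (C := Ch * Cg) fun y => by
      rw [abs_mul]; exact mul_le_mul (hCh y) (hCg y) (abs_nonneg _) hCh0
  have hih : Integrable h (κ x) := integrable_of_bounded (κ x) hh hCh
  have hig : Integrable g (κ x) := integrable_of_bounded (κ x) hg hCg
  have e1 : (fun y => h y * (g y - m)) = fun y => h y * g y - m * h y := by
    funext y; ring
  unfold kop
  rw [e1, integral_sub hihg (hih.const_mul m), integral_const_mul, integral_sub hig (integrable_const m),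
    integral_const, probReal_univ, one_smul]
  ring

/-- **`|kop κ (h g) x − kop κ h x · kop κ g x| ≤ 2 C_h δ`** whenever `|g − m| ≤ δ` for some constant `m`
(`|h| ≤ C_h`; `h, g` bounded measurable). -/
theorem abs_kopCov_le {h g : Ω → ℝ} (hh : Measurable h) {Ch : ℝ} (hCh : ∀ x, |h x| ≤ Ch)
    (hg : Measurable g) {Cg : ℝ} (hCg : ∀ x, |g x| ≤ Cg) {m δ : ℝ} (hδ : ∀ y, |g y - m| ≤ δ) (x : Ω) :
    |kop κ (fun y => h y * g y) x - kop κ h x * kop κ g x| ≤ 2 * Ch * δ := by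
  have hCh0 : 0 ≤ Ch := (abs_nonneg _).trans (hCh x)
  rw [kopCov_eq_sub_const κ hh hCh hg hCg m x]
  have h1 : |kop κ (fun y => h y * (g y - m)) x| ≤ Ch * δ :=
    abs_kop_le κ (fun y => by
      rw [abs_mul]; exact mul_le_mul (hCh y) (hδ y) (abs_nonneg _) hCh0) x
  have h2 : |kop κ h x * kop κ (fun y => g y - m) x| ≤ Ch * δ := by
    rw [abs_mul]
    exact mul_le_mul (abs_kop_le κ hCh x) (abs_kop_le κ hδ x) (abs_nonneg _) hCh0
  calc |kop κ (fun y => h y * (g y - m)) x - kop κ h x * kop κ (fun y => g y - m) x|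
      ≤ |kop κ (fun y => h y * (g y - m)) x| + |kop κ h x * kop κ (fun y => g y - m) x| := abs_sub _ _
    _ ≤ Ch * δ + Ch * δ := add_le_add h1 h2
    _ = 2 * Ch * δ := by ring

/-- The one-step covariance is measurable and bounded by `2 C_h C_g`. -/
theorem kopCov_bounded_measurable {h g : Ω → ℝ} (hh : Measurable h) {Ch : ℝ} (hCh : ∀ x, |h x| ≤ Ch)
    (hg : Measurable g) {Cg : ℝ} (hCg : ∀ x, |g x| ≤ Cg) :
    Measurable (fun x => kop κ (fun y => h y * g y) x - kop κ h x * kop κ g x) ∧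
      ∀ x, |kop κ (fun y => h y * g y) x - kop κ h x * kop κ g x| ≤ 2 * Ch * Cg := by
  refine ⟨(measurable_kop κ (hh.mul hg)).sub ((measurable_kop κ hh).mul (measurable_kop κ hg)),
    fun x => ?_⟩
  exact abs_kopCov_le κ hh hCh hg hCg (m := 0) (fun y => by rw [sub_zero]; exact hCg y) x

end Kernel

/-! ### Increments against the future along the chain -/

section Chain

variable (κ : Kernel Ω Ω) [IsMarkovKernel κ] (μ₀ : Measure Ω) [IsProbabilityMeasure μ₀]

/-- **`E[G · D_b · g(X_{b+1})] = E[G · c_g(X_b)]`** with `c_g = kop κ (h g) − kop κ h · kop κ g`, for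
bounded measurable `G` with `DependsOn G (Set.Iic b)` and bounded measurable `h, g`. -/
theorem chain_increment_mul_next (b : ℕ) {G : (ℕ → Ω) → ℝ} (hG : Measurable G)
    (hGd : DependsOn G (Set.Iic b)) {CG : ℝ} (hCG : ∀ x, |G x| ≤ CG) {h : Ω → ℝ}
    (hh : Measurable h) {Ch : ℝ} (hCh : ∀ x, |h x| ≤ Ch) {g : Ω → ℝ} (hg : Measurable g) {Cg : ℝ}
    (hCg : ∀ x, |g x| ≤ Cg) :
    ∫ x, G x * (h (x (b + 1)) - kop κ h (x b)) * g (x (b + 1))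
        ∂(Kernel.trajMeasure (X := fun _ : ℕ => Ω) μ₀
          (fun n : ℕ => κ.comap (fun h : (i : ↥(Finset.Iic n)) → Ω => h ⟨n, Finset.mem_Iic.2 le_rfl⟩)
            (measurable_pi_apply _)))
      = ∫ x, G x * (kop κ (fun y => h y * g y) (x b) - kop κ h (x b) * kop κ g (x b))
        ∂(Kernel.trajMeasure (X := fun _ : ℕ => Ω) μ₀
          (fun n : ℕ => κ.comap (fun h : (i : ↥(Finset.Iic n)) → Ω => h ⟨n, Finset.mem_Iic.2 le_rfl⟩)
            (measurable_pi_apply _))) := by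
  set P := Kernel.trajMeasure (X := fun _ : ℕ => Ω) μ₀
      (fun n : ℕ => κ.comap (fun h : (i : ↥(Finset.Iic n)) → Ω => h ⟨n, Finset.mem_Iic.2 le_rfl⟩)
        (measurable_pi_apply _)) with hP
  have hCG0 : 0 ≤ CG := (abs_nonneg _).trans (hCG (Classical.choice
    (nonempty_of_isProbabilityMeasure P)))
  have hCh0 : 0 ≤ Ch := (abs_nonneg _).trans (hCh (Classical.choice
    (nonempty_of_isProbabilityMeasure μ₀)))
  have hhg : Measurable fun y => h y * g y := hh.mul hg
  have hChg : ∀ y, |h y * g y| ≤ Ch * Cg := fun y => by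
    rw [abs_mul]; exact mul_le_mul (hCh y) (hCg y) (abs_nonneg _) hCh0
  have hKb : ∀ y, |kop κ h y| ≤ Ch := abs_kop_le κ hCh
  -- (1) `E[G (h g)(X_{b+1})] = E[G K(h g)(X_b)]`
  have h1 := chain_tower_dependsOn κ μ₀ b hG hGd hCG hhg hChg
  rw [← hP] at h1
  -- (2) `E[(G · Kh(X_b)) g(X_{b+1})] = E[G · Kh(X_b) · Kg(X_b)]`
  have hG'm : Measurable fun x : ℕ → Ω => G x * kop κ h (x b) :=
    hG.mul ((measurable_kop κ hh).comp (measurable_pi_apply _))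
  have hG'd : DependsOn (fun x : ℕ → Ω => G x * kop κ h (x b)) (Set.Iic b) := by
    intro x y hxy
    show G x * kop κ h (x b) = G y * kop κ h (y b)
    rw [hGd hxy, hxy b (Set.mem_Iic.2 le_rfl)]
  have hG'b : ∀ x : ℕ → Ω, |G x * kop κ h (x b)| ≤ CG * Ch := fun x => by
    rw [abs_mul]; exact mul_le_mul (hCG x) (hKb _) (abs_nonneg _) hCG0
  have h2 := chain_tower_dependsOn κ μ₀ b hG'm hG'd hG'b hg hCg
  rw [← hP] at h2
  -- integrability
  have hiA : Integrable (fun x : ℕ → Ω => G x * (h (x (b + 1)) * g (x (b + 1)))) P :=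
    integrable_of_bounded P (hG.mul (hhg.comp (measurable_pi_apply _))) (C := CG * (Ch * Cg))
      fun x => by rw [abs_mul]; exact mul_le_mul (hCG x) (hChg _) (abs_nonneg _) hCG0
  have hiB : Integrable (fun x : ℕ → Ω => G x * kop κ h (x b) * g (x (b + 1))) P :=
    integrable_of_bounded P (hG'm.mul (hg.comp (measurable_pi_apply _))) (C := CG * Ch * Cg)
      fun x => by
        rw [abs_mul]
        exact mul_le_mul (hG'b x) (hCg _) (abs_nonneg _) (mul_nonneg hCG0 hCh0)
  have hiC : Integrable (fun x : ℕ → Ω => G x * kop κ (fun y => h y * g y) (x b)) P :=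
    integrable_of_bounded P (hG.mul ((measurable_kop κ hhg).comp (measurable_pi_apply _)))
      (C := CG * (Ch * Cg)) fun x => by
        rw [abs_mul]; exact mul_le_mul (hCG x) (abs_kop_le κ hChg _) (abs_nonneg _) hCG0
  have hiD : Integrable (fun x : ℕ → Ω => G x * kop κ h (x b) * kop κ g (x b)) P :=
    integrable_of_bounded P (hG'm.mul ((measurable_kop κ hg).comp (measurable_pi_apply _)))
      (C := CG * Ch * Cg) fun x => by
        rw [abs_mul]
        exact mul_le_mul (hG'b x) (abs_kop_le κ hCg _) (abs_nonneg _) (mul_nonneg hCG0 hCh0)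
  have hL : ∀ x : ℕ → Ω, G x * (h (x (b + 1)) - kop κ h (x b)) * g (x (b + 1))
      = G x * (h (x (b + 1)) * g (x (b + 1))) - G x * kop κ h (x b) * g (x (b + 1)) := fun x => by
    ring
  have hR : ∀ x : ℕ → Ω, G x * (kop κ (fun y => h y * g y) (x b) - kop κ h (x b) * kop κ g (x b))
      = G x * kop κ (fun y => h y * g y) (x b) - G x * kop κ h (x b) * kop κ g (x b) := fun x => by
    ring
  rw [integral_congr_ae (ae_of_all _ hL), integral_congr_ae (ae_of_all _ hR), integral_sub hiA hiB,
    integral_sub hiC hiD, h1, h2]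

/-- **`E[G · D_b · g(X_{b+1+m})] = E[G · D_b · ((kop κ)^[m] g)(X_{b+1})]`**: the `m`-step tower
property for the history functional `G · D_b` (which depends on times `≤ b + 1`). -/
theorem chain_increment_mul_future (b m : ℕ) {G : (ℕ → Ω) → ℝ} (hG : Measurable G)
    (hGd : DependsOn G (Set.Iic b)) {CG : ℝ} (hCG : ∀ x, |G x| ≤ CG) {h : Ω → ℝ}
    (hh : Measurable h) {Ch : ℝ} (hCh : ∀ x, |h x| ≤ Ch) {g : Ω → ℝ} (hg : Measurable g) {Cg : ℝ}
    (hCg : ∀ x, |g x| ≤ Cg) :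
    ∫ x, G x * (h (x (b + 1)) - kop κ h (x b)) * g (x (b + 1 + m))
        ∂(Kernel.trajMeasure (X := fun _ : ℕ => Ω) μ₀
          (fun n : ℕ => κ.comap (fun h : (i : ↥(Finset.Iic n)) → Ω => h ⟨n, Finset.mem_Iic.2 le_rfl⟩)
            (measurable_pi_apply _)))
      = ∫ x, G x * (h (x (b + 1)) - kop κ h (x b)) * (kop κ)^[m] g (x (b + 1))
        ∂(Kernel.trajMeasure (X := fun _ : ℕ => Ω) μ₀
          (fun n : ℕ => κ.comap (fun h : (i : ↥(Finset.Iic n)) → Ω => h ⟨n, Finset.mem_Iic.2 le_rfl⟩)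
            (measurable_pi_apply _))) := by
  have hCG0 : 0 ≤ CG := (abs_nonneg _).trans (hCG (Classical.choice
    (nonempty_of_isProbabilityMeasure (Kernel.trajMeasure (X := fun _ : ℕ => Ω) μ₀
      (fun n : ℕ => κ.comap (fun h : (i : ↥(Finset.Iic n)) → Ω => h ⟨n, Finset.mem_Iic.2 le_rfl⟩)
        (measurable_pi_apply _))))))
  have hFm : Measurable fun x : ℕ → Ω => G x * (h (x (b + 1)) - kop κ h (x b)) :=
    hG.mul ((hh.comp (measurable_pi_apply _)).sub ((measurable_kop κ hh).comp (measurable_pi_apply _)))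
  have hFd : DependsOn (fun x : ℕ → Ω => G x * (h (x (b + 1)) - kop κ h (x b))) (Set.Iic (b + 1)) := by
    intro x y hxy
    show G x * (h (x (b + 1)) - kop κ h (x b)) = G y * (h (y (b + 1)) - kop κ h (y b))
    rw [hGd (fun i hi => hxy i (Set.mem_Iic.2 ((Set.mem_Iic.1 hi).trans (Nat.le_succ b)))),
      hxy (b + 1) (Set.mem_Iic.2 le_rfl), hxy b (Set.mem_Iic.2 (Nat.le_succ b))]
  have hFb : ∀ x : ℕ → Ω, |G x * (h (x (b + 1)) - kop κ h (x b))| ≤ CG * (2 * Ch) := fun x => by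
    rw [abs_mul]
    refine mul_le_mul (hCG x) ((abs_sub _ _).trans ?_) (abs_nonneg _) hCG0
    linarith [hCh (x (b + 1)), abs_kop_le κ hCh (x b)]
  exact chain_tower_iterate_dependsOn κ μ₀ (b + 1) m hFm hFd hFb hg hCg

variable {κ μ₀}

/-- **AN INCREMENT DECORRELATES FROM THE FUTURE AT THE GEOMETRIC RATE OF THE GAP, UNDER THE
ENVELOPE.**  If `|(kop κ)^[t] g' − ∫ g' dπ| ≤ 2 C_{g'} A ρ^t` for every bounded measurable `g'`, then
for `G` bounded measurable with `DependsOn G (Set.Iic b)`, `|h| ≤ C_h`, `|g| ≤ C_g` measurable and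
every `m`: `|E_{μ₀}[G · D_b · g(X_{b+1+m})]| ≤ 4 C_h C_g (A ρ^m) ∫ |G| dP_{μ₀}`. -/
theorem abs_chain_increment_mul_future_le_of_envelope {π : Measure Ω} {A ρ : ℝ}
    (henv : ∀ (g : Ω → ℝ), Measurable g → ∀ (Cg : ℝ), (∀ x, |g x| ≤ Cg) →
      ∀ (t : ℕ) (x : Ω), |(kop κ)^[t] g x - ∫ y, g y ∂π| ≤ 2 * Cg * (A * ρ ^ t))
    (b m : ℕ) {G : (ℕ → Ω) → ℝ} (hG : Measurable G)
    (hGd : DependsOn G (Set.Iic b)) {CG : ℝ} (hCG : ∀ x, |G x| ≤ CG) {h : Ω → ℝ}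
    (hh : Measurable h) {Ch : ℝ} (hCh : ∀ x, |h x| ≤ Ch) {g : Ω → ℝ} (hg : Measurable g) {Cg : ℝ}
    (hCg : ∀ x, |g x| ≤ Cg) :
    |∫ x, G x * (h (x (b + 1)) - kop κ h (x b)) * g (x (b + 1 + m))
        ∂(Kernel.trajMeasure (X := fun _ : ℕ => Ω) μ₀
          (fun n : ℕ => κ.comap (fun h : (i : ↥(Finset.Iic n)) → Ω => h ⟨n, Finset.mem_Iic.2 le_rfl⟩)
            (measurable_pi_apply _)))|
      ≤ 4 * Ch * Cg * (A * ρ ^ m) * ∫ x, |G x|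
        ∂(Kernel.trajMeasure (X := fun _ : ℕ => Ω) μ₀
          (fun n : ℕ => κ.comap (fun h : (i : ↥(Finset.Iic n)) → Ω => h ⟨n, Finset.mem_Iic.2 le_rfl⟩)
            (measurable_pi_apply _))) := by
  set P := Kernel.trajMeasure (X := fun _ : ℕ => Ω) μ₀
      (fun n : ℕ => κ.comap (fun h : (i : ↥(Finset.Iic n)) → Ω => h ⟨n, Finset.mem_Iic.2 le_rfl⟩)
        (measurable_pi_apply _)) with hP
  obtain ⟨hKm, hKb⟩ := iterate_kop_bounded_measurable κ hg hCg m
  -- the envelope remainder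
  set δ : ℝ := 2 * Cg * (A * ρ ^ m) with hδ
  have hRb : ∀ y, |(kop κ)^[m] g y - ∫ z, g z ∂π| ≤ δ := fun y => henv g hg Cg hCg m y
  -- tower twice
  have h1 := chain_increment_mul_future κ μ₀ b m hG hGd hCG hh hCh hg hCg
  have h2 := chain_increment_mul_next κ μ₀ b hG hGd hCG hh hCh hKm hKb
  rw [← hP] at h1 h2
  rw [h1, h2]
  -- the one-step covariance of `K^m g` is small
  set cφ : Ω → ℝ := fun y => kop κ (fun z => h z * (kop κ)^[m] g z) y
    - kop κ h y * kop κ ((kop κ)^[m] g) y with hcφ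
  have hcb : ∀ y, |cφ y| ≤ 2 * Ch * δ := fun y => abs_kopCov_le κ hh hCh hKm hKb hRb y
  have hiG : Integrable (fun x : ℕ → Ω => |G x|) P := (integrable_of_bounded P hG hCG).abs
  have hiGc : Integrable (fun x : ℕ → Ω => |G x| * (2 * Ch * δ)) P := hiG.mul_const _
  calc |∫ x, G x * cφ (x b) ∂P| = ‖∫ x, G x * cφ (x b) ∂P‖ := (Real.norm_eq_abs _).symm
    _ ≤ ∫ x, ‖G x * cφ (x b)‖ ∂P := norm_integral_le_integral_norm _
    _ ≤ ∫ x, |G x| * (2 * Ch * δ) ∂P := by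
        refine integral_mono_of_nonneg (ae_of_all _ fun x => norm_nonneg _) hiGc
          (ae_of_all _ fun x => ?_)
        show ‖G x * cφ (x b)‖ ≤ |G x| * (2 * Ch * δ)
        rw [Real.norm_eq_abs, abs_mul]
        exact mul_le_mul_of_nonneg_left (hcb _) (abs_nonneg _)
    _ = (∫ x, |G x| ∂P) * (2 * Ch * δ) := integral_mul_const _ _
    _ = 4 * Ch * Cg * (A * ρ ^ m) * ∫ x, |G x| ∂P := by rw [hδ]; ring

end Chain

end Summit.Ventures.LatticeQCDFlow.Scoring

end
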